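import Summits.QuantumFields.YangMills.Theorems.FemtoTransferGapSpectral
import Summits.QuantumFields.YangMills.Theorems.LuscherReductionRunningReductionKTRCalibration
import Summits.QuantumFields.YangMills.Theorems.LuscherReductionRunningReductionKTDoor

/-!
# Crux RED, line «KTR»: the NON-VACUITY CERTIFICATE for `stub_dressedRitz`, UNCONDITIONAL form —
# `RunningReduction → OneSiteLevels → DressedRitz` (rev-3 text verbatim)

Fleet-service module of seat ym-infvol-p2 g4 (route `LuscherReduction`, crux RED `stmt-QuantumFields-19978`).  Closes the chain
`…KTRCalibration.lean` (p492709: certificate modulo fixed-lattice spectral attainment) → `FemtoTransferGapPhysL2.lean` (p494018) →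
`FemtoTransferGapPhysL2Infinite.lean` → `FemtoTransferGapSpectral.lean` (`PhysL2.exists_isPhys_eigenfamily`: attainment PROVED for every level
with `λ_k > 0`).  Here: `levelValue_pos_of_red_one` — deep in the femto window RED ∧ ONE force `λ_k(β,L) > 0` (`μ_k(B) > 0` from ONE at
`B = 2L³/λ³ ≥ B₀`, which `lam ≤ 1/(4·max B₀ 1)` guarantees via `oneSiteCoupling_ge_of_window`, and RED's `μ_kλ₀ ≤ e^{Cλ²/L}λ_kμ₀`) — and the main
theorem `dressedRitz_of_runningReduction_oneSiteLevels`: the two CRUXES of the route imply the rev-3 text of the line's load-bearing witness stub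
(`pub/ym-beyond/p1-g16-files/Lines-KTR.lean` 3cffefe5 ll.578–603, character for character).  Reading: the repaired `DressedRitz` is satisfiable
exactly when the route's cruxes hold — the line «KTR» is not over-strong there (contrast the refutable rev-2 text); it proves nothing OF the cruxes.

HONEST FRAMING: fixed-lattice functional analysis; femto rung R2b1 bookkeeping; nothing here bears on infinite volume, the continuum limit or
the Clay mass gap.
-/

set_option autoImplicit false

noncomputable section

open MeasureTheory Filter Topology Real
open Literature.MathematicalPhysics.QuantumFieldTheory
open Literature.MathematicalPhysics.QuantumLattice
open Literature.Analysis.OperatorTheory.YMMatrixModel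
open scoped BigOperators

namespace Summit.QuantumFields.YangMills.Theorems.FemtoTransferGap.KTRCalibration

open Summit.QuantumFields.YangMills.Theorems.FemtoTransferGap
open Summit.QuantumFields.YangMills.Theorems.FemtoTransferGap.PhysL2

/-- In the femto window, deep enough, RED ∧ ONE make the first `k+1` fine transfer values POSITIVE: `μ_k(B) > 0` (ONE at `B = 2L³/λ³ ≥ B₀`,
guaranteed by `lam ≤ 1/(4·max B₀ 1)`) and RED's lower product inequality `μ_k λ₀ ≤ e^{Cλ²/L} λ_k μ₀` with `λ₀ > 0`. [cite: Luscher1983, §3] -/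
theorem levelValue_pos_of_red_one {k : ℕ} {C B0 lam β : ℝ} {L : ℕ} [NeZero L] (hlam : 0 < lam) (hlam1 : lam ≤ 1)
    (hlamB : lam ≤ 1 / (4 * max B0 1)) (hW : InFemtoWindow lam β L)
    (hONE : ∀ B : ℝ, B0 ≤ B → 0 < levelValue su2Rep 1 B 0 ∧
      Real.exp (-(levelGap k * bareLambda B + C * bareLambda B ^ 2)) * levelValue su2Rep 1 B 0 ≤ levelValue su2Rep 1 B k)
    {C' : ℝ} (hRED : levelValue su2Rep 1 (oneSiteCoupling β L) k * levelValue su2Rep L β 0 ≤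
      Real.exp (C' * luscherLambda β L ^ 2 / L) * (levelValue su2Rep L β k * levelValue su2Rep 1 (oneSiteCoupling β L) 0)) :
    0 < levelValue su2Rep L β k := by
  have hβ : 0 ≤ β := zero_le_one.trans hW.1
  -- the one-site coupling is beyond ONE's threshold
  have hB1 : 1 / (4 * lam ^ 3) ≤ oneSiteCoupling β L := oneSiteCoupling_ge_of_window hlam hW
  have hM1 : (1 : ℝ) ≤ max B0 1 := le_max_right _ _
  have hM0 : 0 < max B0 1 := zero_lt_one.trans_le hM1
  have hlam3 : lam ^ 3 ≤ lam := by
    have h1 : lam ^ 3 = lam * (lam * lam) := by ring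
    rw [h1]
    have h2 : lam * lam ≤ 1 := by nlinarith
    nlinarith
  have hB0 : B0 ≤ oneSiteCoupling β L := by
    have h1 : max B0 1 ≤ 1 / (4 * lam) := by
      rw [le_div_iff₀ (by positivity)]
      have := (le_div_iff₀ (by positivity : (0 : ℝ) < 4 * max B0 1)).mp hlamB
      linarith
    have h2 : 1 / (4 * lam) ≤ 1 / (4 * lam ^ 3) :=
      one_div_le_one_div_of_le (by positivity) (by linarith)
    exact (le_max_left B0 1).trans (h1.trans (h2.trans hB1))
  obtain ⟨hμ0, hμk⟩ := hONE _ hB0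
  have hμk' : 0 < levelValue su2Rep 1 (oneSiteCoupling β L) k := (mul_pos (Real.exp_pos _) hμ0).trans_le hμk
  have hl0 : 0 < levelValue su2Rep L β 0 := levelValue_zero_su2Rep_pos L β
  have hlhs : 0 < levelValue su2Rep 1 (oneSiteCoupling β L) k * levelValue su2Rep L β 0 := mul_pos hμk' hl0
  have hrhs := hlhs.trans_le hRED
  have hprod : 0 < levelValue su2Rep L β k * levelValue su2Rep 1 (oneSiteCoupling β L) 0 :=
    pos_of_mul_pos_right hrhs (Real.exp_pos _).le
  exact pos_of_mul_pos_left hprod hμ0.le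

/-- ★★ **KTR NON-VACUITY CERTIFICATE, UNCONDITIONAL FORM: `RunningReduction → OneSiteLevels → DressedRitz`.**  The two cruxes of route
`LuscherReduction` imply the rev-3 text of `stub_dressedRitz` (line «KTR», 3cffefe5 ll.578–603, verbatim below): the attainment hypothesis of
`dressedRitz_of_runningReduction` (p492709) is discharged by `PhysL2.exists_isPhys_eigenfamily` (spectral attainment at fixed lattice), whose
positivity premise `0 < λ_k` holds deep in the window by `levelValue_pos_of_red_one`.  So the repaired witness stub is EXACTLY as hard as the crux it
serves and no harder: the line «KTR» is not vacuous at `stub_dressedRitz`. [cite: ReedSimonIV1978, Thm. XIII.1] [cite: Luscher1983, §3] -/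
theorem dressedRitz_of_runningReduction_oneSiteLevels
    (hRED : Summit.QuantumFields.YangMills.Theses.LuscherReduction.RunningReduction)
    (hONE : Summit.QuantumFields.YangMills.Theses.LuscherReduction.OneSiteLevels) :
    ∀ k : ℕ, ∀ η : ℝ, 0 < η → ∃ C lam0 : ℝ, 0 < lam0 ∧ ∀ lam : ℝ, 0 < lam → lam ≤ lam0 →
    ∃ L0 : ℕ, ∀ (L : ℕ) [NeZero L], L0 ≤ L → ∀ β : ℝ, InFemtoWindow lam β L →
      ∃ φ : Fin (k + 1) → (GaugeConfig 3 L SU2 → ℝ),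
        (∀ i, IsPhys (φ i)) ∧
        (∀ i l, l2 (φ i) (φ l) = if i = l then 1 else 0) ∧
        (∀ i l, i ≠ l → qform su2Rep β (φ i) (φ l) = 0) ∧
        (∀ i l : Fin (k + 1), i ≤ l → qform su2Rep β (φ l) (φ l) ≤ qform su2Rep β (φ i) (φ i)) ∧
        (∀ j : Fin (k + 1),
          qform su2Rep β (φ j) (φ j) * levelValue su2Rep 1 (oneSiteCoupling β L) 0 ≤
              Real.exp (C * luscherLambda β L ^ 2 / L) *
                (levelValue su2Rep 1 (oneSiteCoupling β L) j * qform su2Rep β (φ 0) (φ 0)) ∧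
            levelValue su2Rep 1 (oneSiteCoupling β L) j * qform su2Rep β (φ 0) (φ 0) ≤
              Real.exp (C * luscherLambda β L ^ 2 / L) *
                (qform su2Rep β (φ j) (φ j) * levelValue su2Rep 1 (oneSiteCoupling β L) 0)) ∧
        (∀ c : Fin (k + 1) → ℝ,
          l2 (∑ i, c i • (transferApply β (φ i) - qform su2Rep β (φ i) (φ i) • φ i))
             (∑ i, c i • (transferApply β (φ i) - qform su2Rep β (φ i) (φ i) • φ i)) ≤
            C * (luscherLambda β L ^ 3 / (L : ℝ) ^ 2) * qform su2Rep β (φ 0) (φ 0) ^ 2 * ∑ i, c i ^ 2) ∧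
        (∀ ψ : GaugeConfig 3 L SU2 → ℝ, IsPhys ψ →
          qform su2Rep β ψ ψ ≤ Real.exp (η * luscherLambda β L / L) * qform su2Rep β (φ 0) (φ 0) * l2 ψ ψ) := by
  intro k η hη
  obtain ⟨C, lam0, hlam0, hC⟩ := runningReduction_uniform hRED k
  obtain ⟨Ck, B0, hB0⟩ := hONE k
  refine ⟨max C 0, min lam0 (min 1 (1 / (4 * max B0 1))), lt_min hlam0 (lt_min one_pos (by positivity)), fun lam hlam hle => ?_⟩
  obtain ⟨L0, hL⟩ := hC lam hlam (hle.trans (min_le_left _ _))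
  refine ⟨L0, fun L _ hL0 β hW => ?_⟩
  have hβ1 : 1 ≤ β := hW.1
  have hβ : 0 ≤ β := zero_le_one.trans hβ1
  have hB : 0 ≤ oneSiteCoupling β L := oneSiteCoupling_nonneg β L
  have hlam_nn : 0 ≤ luscherLambda β L := luscherLambda_nonneg β L
  have ht : 0 ≤ luscherLambda β L ^ 2 / L := div_nonneg (sq_nonneg _) (Nat.cast_nonneg L)
  -- positivity of `λ_k`, then attainment
  have hk : 0 < levelValue su2Rep L β k :=
    levelValue_pos_of_red_one hlam ((hle.trans (min_le_right _ _)).trans (min_le_left _ _))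
      ((hle.trans (min_le_right _ _)).trans (min_le_right _ _)) hW (fun B hB => ⟨(hB0 B hB).1, (hB0 B hB).2.2⟩)
      (hL L hL0 β hW k le_rfl).2
  obtain ⟨φ, hφ, hon, heig⟩ := exists_isPhys_eigenfamily hβ k hk
  have hritz : ∀ i : Fin (k + 1), qform su2Rep β (φ i) (φ i) = levelValue su2Rep L β i := ritz_of_eigen hon heig
  have hm0 : qform su2Rep β (φ 0) (φ 0) = levelValue su2Rep L β 0 := by rw [hritz 0, Fin.val_zero]
  have hlv0 : 0 ≤ levelValue su2Rep L β 0 := levelValue_su2Rep_nonneg L hβ 0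
  refine ⟨φ, hφ, hon, fun i l hil => ?_, fun i l hil => ?_, fun j => ?_, fun c => ?_, fun ψ hψ => ?_⟩
  · rw [qform_of_eigen_orthonormal hon heig, if_neg hil]
  · rw [hritz, hritz]
    exact levelValue_antitone hβ (Fin.le_def.mp hil)
  · rw [hritz j, hm0]
    obtain ⟨ha, hb⟩ := hL L hL0 β hW j (Nat.lt_succ_iff.mp j.2)
    have hY₁ : 0 ≤ levelValue su2Rep 1 (oneSiteCoupling β L) j * levelValue su2Rep L β 0 :=
      mul_nonneg (levelValue_su2Rep_nonneg 1 hB j) hlv0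
    have hY₂ : 0 ≤ levelValue su2Rep L β j * levelValue su2Rep 1 (oneSiteCoupling β L) 0 :=
      mul_nonneg (levelValue_su2Rep_nonneg L hβ j) (levelValue_su2Rep_nonneg 1 hB 0)
    exact ⟨le_exp_mul_div_of_le ha ht hY₁ (le_max_left C 0), le_exp_mul_div_of_le hb ht hY₂ (le_max_left C 0)⟩
  · rw [residual_eq_zero hon heig c, l2_zero_zero]
    have h1 : 0 ≤ max C 0 * (luscherLambda β L ^ 3 / (L : ℝ) ^ 2) :=
      mul_nonneg (le_max_right _ _) (div_nonneg (pow_nonneg hlam_nn 3) (sq_nonneg _))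
    exact mul_nonneg (mul_nonneg h1 (sq_nonneg _)) (Finset.sum_nonneg fun i _ => sq_nonneg (c i))
  · rw [hm0]
    have hexp : 1 ≤ Real.exp (η * luscherLambda β L / L) :=
      Real.one_le_exp (div_nonneg (mul_nonneg hη.le hlam_nn) (Nat.cast_nonneg L))
    have hl2 : 0 ≤ l2 ψ ψ := l2_self_nonneg ψ
    rcases hl2.eq_or_lt with h0 | hpos
    · rw [← h0, mul_zero, qform_eq_zero_of_l2_eq_zero β hψ h0.symm]
    · calc qform su2Rep β ψ ψ ≤ levelValue su2Rep L β 0 * l2 ψ ψ :=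
            qform_le_levelValue_zero_mul su2Rep continuous_su2Rep β hψ hpos
        _ = 1 * levelValue su2Rep L β 0 * l2 ψ ψ := by rw [one_mul]
        _ ≤ Real.exp (η * luscherLambda β L / L) * levelValue su2Rep L β 0 * l2 ψ ψ :=
            mul_le_mul_of_nonneg_right (mul_le_mul_of_nonneg_right hexp hlv0) hl2

end Summit.QuantumFields.YangMills.Theorems.FemtoTransferGap.KTRCalibration

end
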